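import Summits.HodgeConjecture.HodgeConjecture.Theorems.F0P3JacquetEmbeddingDichotomy       -- ★ p832963 D1∕D2
import Literature.NumberTheory.Automorphic.PrincipalSeriesSphericalUnramified               -- ★ `eq_one_of_fixedPoints_cmPrincipalSeries_ne_bot`
import Literature.NumberTheory.Automorphic.HeckeEigencharacterPackage                     -- ★ `IrrClass.IsSpherical`, `isSpherical_mk` (ED. 2)
import HarnessLib

/-!
# Crux `H413` — a `K_v`-spherical irreducible representation of `U(Φ₃)(L⁺_v)` is supercuspidal or embeds into an UNRAMIFIED principal series

Cell hodgecm-mathlib (D-0151), FLOOR 0, crux item H413 = stmt-HodgeConjecture-24833 (`--supports`, helper; desk F0P3b-plan (g10), row (A″),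
2026-08-31).  HC_CM is proved only modulo the 2 remaining named inputs (hLiu418, h413) until rung 0 closes; nothing here proves HC_CM.

THE MATHEMATICS [CartierCorvallis1979, §III.3–§IV.1; Casselman1980, §3; BernsteinZelevinsky1977, Prop. 1.9 (b), §2.5; Rogawski1990, §12.1–12.2].
`G = U(Φ₃)(L⁺_v)` (★ `Gqs L v`), `K_v = U(Φ₃)(𝒪_v)` (★ `cmLocalIntegralLevel L 3 Φ₃ v`), `π = r.ρ` irreducible smooth with a non-zero `K_v`-fixed vector.
* **D3** `exists_injective_intertwiningMap_cmPrincipalSeries_unramified`: if `r_B(π) ≠ 0` then `π ↪ i_G(χ₁, χ₂)` for CONTINUOUS `χ₁, χ₂` with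
  `(χ₁, χ₂)` TRIVIAL ON `T ∩ K_v` — ★ D1 (`F0P3JacquetEmbeddingDichotomy`) gives the embedding `f`; `f` carries the non-zero `K_v`-fixed vector
  of `π` to a non-zero `K_v`-fixed vector of `i_G(χ₁, χ₂)` (`f` intertwines and is injective), and ★ `eq_one_of_fixedPoints_cmPrincipalSeries_ne_bot`
  (Iwasawa `G = B K_v`, `δ_B = 1` on `B ∩ K_v`) reads off `χ = 1` on `T ∩ K_v`.
* **D4** `isSupercuspidal_or_exists_injective_intertwiningMap_cmPrincipalSeries_unramified` (non-split `v`): `π` is supercuspidal, or as in D3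
  (★ N6 `u3_isSupercuspidal_iff_jacquet_eq_zero_holds` + D3).  With ★ K3 `SupercuspidalNotSphericalCofinite` the first alternative is excluded
  at all but finitely many `v`; this is the «spherical ⇒ sub of an unramified principal series» input of the SqNS (#90) ∕ Satake roads, letter-free.
Theorems only; no definition, no named fact, no instance.  ELABORATION: as in ★ `F0P3JacquetEmbeddingDichotomy` (`have`+`rcases`, never
`obtain … := term` at this carrier; one budgeted declaration).

## References
* [CartierCorvallis1979] P. Cartier, *Representations of p-adic groups: a survey*, §III.3, §IV.1.  * [Casselman1980] §3.
* [BernsteinZelevinsky1977] Prop. 1.9 (b), §2.3–2.5.  * [Rogawski1990] §4.5 p. 45, §12.1 pp. 171–172, §12.2 pp. 173–174.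
-/

set_option autoImplicit false
-- the mandated namespace has the single-problem summit's repeated segment (`HodgeConjecture.HodgeConjecture`)
set_option linter.dupNamespace false

noncomputable section

open NumberField IsDedekindDomain MeasureTheory
open scoped Matrix

namespace Summit.HodgeConjecture.HodgeConjecture.Cruxes.H413.F0P3SphericalEmbedsUnramified

open Literature.NumberTheory Literature.NumberTheory.Automorphic Literature.NumberTheory.Automorphic.UnitaryGroup
open Literature.NumberTheory.Rogawski1990

variable (L : Type) [Field L] [NumberField L] [IsCMField L]

set_option maxHeartbeats 2000000 in  -- one carrier crossing (`f x` as a vector of `i_G(χ)`), as in ★ D1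
/-- **D3 — a `K_v`-spherical irreducible smooth representation of `U(Φ₃)(L⁺_v)` with non-zero Jacquet module embeds into an UNRAMIFIED
principal series `i_G(χ₁, χ₂)`** (`χ₁, χ₂` continuous and `(χ₁, χ₂) = 1` on `T ∩ K_v`; every finite `v`).
[cite: CartierCorvallis1979, §III.3, §IV.1] [cite: BernsteinZelevinsky1977, Prop. 1.9 (b), §2.3] [cite: Rogawski1990, §12.1 pp. 171–172; §12.2 pp. 173–174] -/
theorem exists_injective_intertwiningMap_cmPrincipalSeries_unramified (v : HeightOneSpectrum (𝓞 ↥(maximalRealSubfield L)))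
    (r : SmoothIrrep (Gqs L v))
    (hK : r.ρ.fixedPoints (cmLocalIntegralLevel L 3 (qsForm L) v) ≠ ⊥)
    (h : ¬ Subsingleton ((cmBorelTriple L 3 v).restrict r.ρ).Coinvariants) :
    ∃ (χ₁ : (LocalRing L v)ˣ →* ℂˣ) (χ₂ : ↥(normOneUnits (conjLocal L (IsCMField.complexConj L) v)) →* ℂˣ),
      Continuous (fun x => ((χ₁ x : ℂˣ) : ℂ)) ∧ Continuous (fun x => ((χ₂ x : ℂˣ) : ℂ)) ∧
      (∀ t : ↥(torusU (conjLocal L (IsCMField.complexConj L) v) (cmLocalForm L 3 v)),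
        (t : ↥(unitaryGroupOfForm (conjLocal L (IsCMField.complexConj L) v) (cmLocalForm L 3 v))) ∈
          cmLocalIntegralLevel L 3 (qsForm L) v → cmTorusCharPair L v χ₁ χ₂ t = 1) ∧
      ∃ f : r.ρ.IntertwiningMap (cmPrincipalSeries L 3 v (cmTorusCharPair L v χ₁ χ₂)), Function.Injective f := by
  have hD1 := F0P3JacquetEmbeddingDichotomy.exists_injective_intertwiningMap_cmPrincipalSeries L v r h
  rcases hD1 with ⟨χ₁, χ₂, h1c, h2c, f, hf⟩
  -- a non-zero `K_v`-fixed vector of `π` goes to a non-zero `K_v`-fixed vector of `i_G(χ₁, χ₂)`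
  have hx' := (Submodule.ne_bot_iff _).1 hK
  rcases hx' with ⟨x, hx, hx0⟩
  have hfx : f x ≠ 0 := fun h0 => hx0 (hf (by rw [h0, map_zero]))
  haveI := locallyCompactSpace_cmBorelU L 3 v
  have hne : (cmPrincipalSeries L 3 v (cmTorusCharPair L v χ₁ χ₂)).fixedPoints (cmLocalIntegralLevel L 3 (qsForm L) v) ≠ ⊥ := by
    refine (Submodule.ne_bot_iff _).2 ⟨f x, ?_, hfx⟩
    rw [Representation.mem_fixedPoints] at hx ⊢
    intro g hg
    -- (`exact`, not `rw`: the two spellings of `G` — `Gqs L v` vs the matrix group — agree only up to unfolding `cmDatum`)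
    have hfi := LinearMap.congr_fun (f.isIntertwining' g) x
    simp only [LinearMap.coe_comp, Function.comp_apply] at hfi
    rw [hx g hg] at hfi
    exact hfi.symm
  exact ⟨χ₁, χ₂, h1c, h2c, fun t ht => eq_one_of_fixedPoints_cmPrincipalSeries_ne_bot L 3 v (cmTorusCharPair L v χ₁ χ₂) hne t ht,
    f, hf⟩

/-- **D4 — dichotomy for `K_v`-spherical irreducibles at a non-split place**: supercuspidal, or a sub of an UNRAMIFIED principal series
(★ N6 `u3_isSupercuspidal_iff_jacquet_eq_zero_holds` + D3). [cite: Rogawski1990, §12.1 pp. 171–172; §12.2 p. 173] [cite: Casselman1995, Thm. 5.1.2, Thm. 5.3.1]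
[cite: CartierCorvallis1979, §IV.1] -/
theorem isSupercuspidal_or_exists_injective_intertwiningMap_cmPrincipalSeries_unramified
    (v : HeightOneSpectrum (𝓞 ↥(maximalRealSubfield L)))
    (hns : ∀ w : PlacesOver L v, IsCMField.complexConj L • w.1 = w.1) (r : SmoothIrrep (Gqs L v))
    (hK : r.ρ.fixedPoints (cmLocalIntegralLevel L 3 (qsForm L) v) ≠ ⊥) :
    (IrrClass.mk r).IsSupercuspidal ∨
      ∃ (χ₁ : (LocalRing L v)ˣ →* ℂˣ) (χ₂ : ↥(normOneUnits (conjLocal L (IsCMField.complexConj L) v)) →* ℂˣ),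
        Continuous (fun x => ((χ₁ x : ℂˣ) : ℂ)) ∧ Continuous (fun x => ((χ₂ x : ℂˣ) : ℂ)) ∧
        (∀ t : ↥(torusU (conjLocal L (IsCMField.complexConj L) v) (cmLocalForm L 3 v)),
          (t : ↥(unitaryGroupOfForm (conjLocal L (IsCMField.complexConj L) v) (cmLocalForm L 3 v))) ∈
            cmLocalIntegralLevel L 3 (qsForm L) v → cmTorusCharPair L v χ₁ χ₂ t = 1) ∧
        ∃ f : r.ρ.IntertwiningMap (cmPrincipalSeries L 3 v (cmTorusCharPair L v χ₁ χ₂)), Function.Injective f := by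
  by_cases hsub : Subsingleton ((cmBorelTriple L 3 v).restrict r.ρ).Coinvariants
  · exact Or.inl ((u3_isSupercuspidal_iff_jacquet_eq_zero_holds L v hns r).2 hsub)
  · exact Or.inr (exists_injective_intertwiningMap_cmPrincipalSeries_unramified L v r hK hsub)

/-! ## ED. 2 (append-only): the class-level form, hypothesis `c.IsSpherical K_v` as the T2∕SqNS consumers state it -/

/-- **D5 — class-level dichotomy for `K_v`-SPHERICAL classes at a non-split place**: a `K_v`-spherical irreducible class `c` of
`U(Φ₃)(L⁺_v)` (★ `IrrClass.IsSpherical`: `dim π^{K_v} = 1`) is supercuspidal, or it is the class of an `r` that embeds into an UNRAMIFIED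
principal series `i_G(χ₁, χ₂)` (`χ₁, χ₂` continuous, `(χ₁, χ₂) = 1` on `T ∩ K_v`) — D4 at a representative (★ `IrrClass.mk_surjective`,
★ `IrrClass.isSpherical_mk`, `IsSpherical ⇒ IsUnramified`). [cite: Rogawski1990, §12.1 pp. 171–172; §12.2 p. 173] [cite: CartierCorvallis1979, §IV.1]
[cite: Casselman1995, Thm. 5.1.2, Thm. 5.3.1] -/
theorem isSupercuspidal_or_exists_unramified_embedding_of_isSpherical
    (v : HeightOneSpectrum (𝓞 ↥(maximalRealSubfield L)))
    (hns : ∀ w : PlacesOver L v, IsCMField.complexConj L • w.1 = w.1) (c : IrrClass (Gqs L v))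
    (hc : c.IsSpherical (cmLocalIntegralLevel L 3 (qsForm L) v)) :
    c.IsSupercuspidal ∨
      ∃ r : SmoothIrrep (Gqs L v), IrrClass.mk r = c ∧
        ∃ (χ₁ : (LocalRing L v)ˣ →* ℂˣ) (χ₂ : ↥(normOneUnits (conjLocal L (IsCMField.complexConj L) v)) →* ℂˣ),
          Continuous (fun x => ((χ₁ x : ℂˣ) : ℂ)) ∧ Continuous (fun x => ((χ₂ x : ℂˣ) : ℂ)) ∧
          (∀ t : ↥(torusU (conjLocal L (IsCMField.complexConj L) v) (cmLocalForm L 3 v)),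
            (t : ↥(unitaryGroupOfForm (conjLocal L (IsCMField.complexConj L) v) (cmLocalForm L 3 v))) ∈
              cmLocalIntegralLevel L 3 (qsForm L) v → cmTorusCharPair L v χ₁ χ₂ t = 1) ∧
          ∃ f : r.ρ.IntertwiningMap (cmPrincipalSeries L 3 v (cmTorusCharPair L v χ₁ χ₂)), Function.Injective f := by
  -- a representative `r` of `c` (no `subst`: the goal carries the ≈ 10⁷-node carrier, `c`'s own statements are small)
  have hc' := IrrClass.mk_surjective c
  rcases hc' with ⟨r, hr⟩
  rw [← hr] at hc
  have hK : r.ρ.fixedPoints (cmLocalIntegralLevel L 3 (qsForm L) v) ≠ ⊥ :=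
    ((IrrClass.isSpherical_mk r _).1 hc).isUnramified
  have hD4 := isSupercuspidal_or_exists_injective_intertwiningMap_cmPrincipalSeries_unramified L v hns r hK
  rcases hD4 with h | h
  · left
    rw [← hr]
    exact h
  · exact Or.inr ⟨r, hr, h⟩

end Summit.HodgeConjecture.HodgeConjecture.Cruxes.H413.F0P3SphericalEmbedsUnramified

end
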